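/-
Copyright: the b2b-balaban T⁴-continuum CRUX team, row NE7b leaf lineage `t4-ne7b-formalise-leaf-03` (gen 146). Project licence.
-/
import Mathlib.Analysis.Calculus.FDeriv.Basic
import Mathlib.Analysis.Normed.Operator.Bilinear
import Mathlib.Analysis.Calculus.FDeriv.Linear

/-!
# THE SECOND-ORDER ENVELOPE THEOREM FOR A NONLINEAR CONSTRAINT (Peano form): the value function
# `φ w = inf {V δ : G δ = w}` of a NONLINEAR constraint map `G` has at `w₀ = G δ₀` the expansion
# `φ (w₀ + h) = φ w₀ + Λ h + 𝓛 (N h) + o(‖h‖²)`, whose quadratic term is the constrained Schur form (over the fibres of the LINEARISED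
# constraint `T = DG(δ₀)`) of the LAGRANGIAN FORM `𝓛 = q − s` — `V`'s own second-order form `q` MINUS the «multiplier × curvature» form
# `s v = ½ Λ(D²G(δ₀)[v, v])` — T-85 (L2) + (L3): the second-order half of T-80 (J1) under a nonlinear constraint, with print's letters
# (the global curvature bound (135), the linearising section (47) + (55), «small because `J` is small») displayed and NO implicit function
# (row NE7b, node U5c; residual (R2′) family (2), letter (ℓ1); Mathlib only)

Cell `pub-balaban`, sub-cell `t4`, spine estimate NE7b (`T4WeightBudget.RelWeightBound`; the cell's OWN estimate — NOT PRINTED in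
[Bałaban 1983–89], NOT PROVED).  Crux-route work under `Spine/NE7b/` by a row leaf on the convexity road; NOTHING of Bałaban's is named
or asserted; no `T4Continuum/Support` leaf typed (FREEZE (0)); no `def`; zero `sorry`.  Imports: Mathlib only — independent of the
farm's `Spine/NE7b` olean frontier and of this lineage's `…ConstrainedValueSecondOrder` (CVS, the LINEAR case), whose §1 identifies the
quadratic term `𝓛 ∘ N` below with the constrained infimum `𝓛_T h = ⨅_{T v = h} 𝓛 v` BY NAME (`constrInf_eq_apply_fibreMin`).

WHY.  Idea-1's T-85 (g85) locates the SU(2) delta of junction (J1): Bałaban's averaging constraint is NONLINEAR (`Q_k(U₀, ηA) =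
Q_k(U₀)A + C_k(U₀, A)`, `|C_k| ≤ C₂|A|²`, CMP 98 (134)–(135)), linearised by a chart `A = A′ − HD(A′)` with second-order contact
(`|D(A′)| ≤ 4C₂|A′|²`, CMP 102 (47) + (55)), and the linearisation «creates new quadratic terms … small because the configuration `J` is
small» ([B9] p.421 (3.127)–(3.128); CMP 109 (2.11)): the value Hessian is the constrained Schur complement of the LAGRANGIAN Hessian
`D²V − λ∘D²G` (T-85 §2 (E2), TOY 2).  THIS FILE types (E2) DIRECTLY in Peano currency, with no implicit function: the chart enters only as a
displayed SECTION letter for the upper bound (`G (σ h) = w₀ + h` near `0`, `σ h − δ₀ − N h = o(h)` — print's (47) + (55), which give `O(‖h‖²)`),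
the curvature through the scalar letter `Λ (G (δ₀ + v) − G δ₀ − T v) = s v + o(‖v‖²)` and the STRONG first-order letter in
constraint-adapted form `V δ₀ + Λ (G δ − G δ₀) + μ‖δ − δ₀‖² ≤ V δ` (§2: from the road's strong letter with modulus `m∕2`, the Lagrange
condition `V′ = Λ ∘ T` and the GLOBAL «multiplier × curvature» bound `|Λ (G (δ₀ + v) − G δ₀ − T v)| ≤ ρ‖v‖²`, `ρ < m∕2` — T-85 TOY 1's
non-degeneracy, print's `B₀C₂‖J‖` small); the lower bound compares the nonlinear fibre over `w₀ + h` with the linear fibres over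
`h − remainder` through a quadratic modulus of `𝓛` (automatic for bounded bilinear forms, §1).

WHAT IS PROVED ([folklore]; Fiacco, *Introduction to Sensitivity and Stability Analysis in NLP* (1983) §3.2 ∕ Bonnans–Shapiro (2000)
§4.7 print the `C²` statement with the Lagrangian Hessian; the Peano form below is the elementary two-competitor argument):
* §1 LETTER ALGEBRA: `eventually_abs_le_sq_of_isLittleO`, `apply_zero_of_isLittleO_sq`, `eventually_norm_remainder_le_of_hasFDerivAt`,
  **`abs_bilin_sub_bilin_le`** (a bounded bilinear form has the quadratic modulus `|B u u − B v v| ≤ ‖B‖(‖u‖ + ‖v‖)‖u − v‖`).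
* §2 **`firstOrderG_of_firstOrder`** (strong letter with `m∕2`, `V′ = Λ ∘ T`, global `|Λ (G (δ₀ + v) − G δ₀ − T v)| ≤ ρ‖v‖²` ⊢ the
  constraint-adapted letter `V δ₀ + Λ (G δ − G δ₀) + (m∕2 − ρ)‖δ − δ₀‖² ≤ V δ`), `le_of_firstOrderG`, **`isMinOn_fibre_of_firstOrderG`**
  (`μ ≥ 0` ⊢ `δ₀` minimises `V` on `{G δ = G δ₀}` — the non-degeneracy clause as a theorem).
* §3 **`lagrangian_constrValue_upper`** (section letter, `V′ = Λ ∘ T`, upper letter of `V`, lower letter of `Λ ∘ (G − G δ₀ − T)`,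
  quadratic modulus of `𝓛 = q − s` ⊢ eventually `φ (w₀ + h) ≤ φ w₀ + Λ h + 𝓛 (N h) + ε‖h‖²`; competitor `σ h`, the curvature entering
  through `V′ (σ h − δ₀ − N h) = −Λ(remainder)`).
* §4 **`lagrangian_constrValue_lower`** (`HasFDerivAt G T δ₀`, `V′ = Λ ∘ T`, the constraint-adapted strong letter with `μ > 0`, lower
  letter of `V`, upper letter of `Λ ∘ (G − G δ₀ − T)`, quadratic modulus of `𝓛`, `N` minimising `𝓛` on the fibres of `T` ⊢ eventually
  `φ w₀ + Λ h + 𝓛 (N h) ≤ φ (w₀ + h) + ε‖h‖²`).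
* §5 THE END **`isLittleO_constrValue_lagrangian`**: `(h ↦ φ (w₀ + h) − φ w₀ − Λ h − 𝓛 (N h)) =o[𝓝 0] ‖h‖²` — THE VALUE FUNCTION's
  SECOND-ORDER TERM IS THE CONSTRAINED SCHUR FORM OF THE LAGRANGIAN FORM `𝓛 = q − s` (= `𝓛_T` by CVS §1; unique by
  `…ConstrainedValueHessian` §1); `G` linear (`s = 0`, `σ h = δ₀ + N h`) returns CVS §5.  §6: a non-vacuity `example` (`G = T = N = id`).

NOT HERE (honest): EXISTENCE of the section `σ` (implicit function theorem — Mathlib `HasStrictFDerivAt.implicitFunction`; print's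
contraction (50)–(55)) and of the fibre minimiser `N` of `𝓛` (CSTF §4 `exists_constrMin`); `C²`-regularity of `φ`; gauge orbits (T-85 #28:
`E` is the slice); the nested two-level insertion (T-85 #29); which `V`, `G`, `Λ` of Bałaban's ((A3) ∕ (A1c), NC-NE7b-α UNRULED); any value
of `C₂`, `B₀`, `γ₀`.  BY-NAME EFFECT ON THE WALL: NONE.  NE7b NOT PRINTED ∕ NOT PROVED; spine PROVED 0∕9; rung (B)+1 on a FINITE torus —
NOT infinite volume, NOT the mass gap, NOT Clay.  HONEST DEPENDENCY: continuum YM on T⁴ ⇐ BetaPertH ∧ nine spine estimates (0/9 proved);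
BetaPertH ⇐ (D1) ∧ (D4) ∧ CAP+tail; G-an2-4 gates asym, D1 and NE2∕3∕4.
-/

set_option autoImplicit false

open Set Function Filter Asymptotics Metric
open scoped Topology

namespace Summit.QuantumFields.BalabanUV.T4Continuum.NE7b.ConstrainedValueLagrangian

section Main

variable {E F : Type*} [NormedAddCommGroup E] [NormedSpace ℝ E] [NormedAddCommGroup F] [NormedSpace ℝ F]

/-! ## §1 Letter algebra: one-sided letters from `o(‖v‖²)`, the remainder of a derivative, the quadratic modulus of a bilinear form -/

omit [NormedSpace ℝ E] in
/-- From `r =o[𝓝 0] ‖·‖²`: `∀ ε > 0`, eventually `|r v| ≤ ε‖v‖²`. [folklore] -/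
theorem eventually_abs_le_sq_of_isLittleO {r : E → ℝ} (hr : r =o[𝓝 (0 : E)] fun v => ‖v‖ ^ 2) {ε : ℝ} (hε : 0 < ε) :
    ∀ᶠ v in 𝓝 (0 : E), |r v| ≤ ε * ‖v‖ ^ 2 := by
  filter_upwards [hr.def hε] with v hv
  rwa [Real.norm_eq_abs, Real.norm_of_nonneg (by positivity)] at hv

omit [NormedSpace ℝ E] in
/-- From `r =o[𝓝 0] ‖·‖²`: `r 0 = 0` (the bound holds at the base point itself). [folklore] -/
theorem apply_zero_of_isLittleO_sq {r : E → ℝ} (hr : r =o[𝓝 (0 : E)] fun v => ‖v‖ ^ 2) : r 0 = 0 := by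
  have h := (eventually_abs_le_sq_of_isLittleO hr one_pos).self_of_nhds
  rw [norm_zero] at h
  exact abs_eq_zero.1 (le_antisymm (by simpa using h) (abs_nonneg _))

/-- From `HasFDerivAt G T δ₀`: `∀ ε > 0`, eventually `‖G (δ₀ + v) − G δ₀ − T v‖ ≤ ε‖v‖`. [folklore] -/
theorem eventually_norm_remainder_le_of_hasFDerivAt {G : E → F} {T : E →L[ℝ] F} {δ₀ : E} (hT : HasFDerivAt G T δ₀) {ε : ℝ}
    (hε : 0 < ε) : ∀ᶠ v in 𝓝 (0 : E), ‖G (δ₀ + v) - G δ₀ - T v‖ ≤ ε * ‖v‖ :=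
  (hasFDerivAt_iff_isLittleO_nhds_zero.1 hT).def hε

/-- **THE QUADRATIC MODULUS OF A BOUNDED BILINEAR FORM**: `|B u u − B v v| ≤ ‖B‖(‖u‖ + ‖v‖)‖u − v‖` — the §3–§5 letter `hLmod` for
`𝓛 v = B v v` (e.g. `½ D²V(δ₀)[v, v] − ½ Λ(D²G(δ₀)[v, v])`). [folklore] -/
theorem abs_bilin_sub_bilin_le (B : E →L[ℝ] E →L[ℝ] ℝ) (u v : E) : |B u u - B v v| ≤ ‖B‖ * (‖u‖ + ‖v‖) * ‖u - v‖ := by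
  have h1 : B u u - B v v = B (u - v) u + B v (u - v) := by
    simp only [map_sub, sub_apply]
    ring
  rw [h1]
  have h2 : |B (u - v) u| ≤ ‖B‖ * ‖u - v‖ * ‖u‖ := by
    rw [← Real.norm_eq_abs]
    exact B.le_opNorm₂ (u - v) u
  have h3 : |B v (u - v)| ≤ ‖B‖ * ‖v‖ * ‖u - v‖ := by
    rw [← Real.norm_eq_abs]
    exact B.le_opNorm₂ v (u - v)
  calc |B (u - v) u + B v (u - v)| ≤ |B (u - v) u| + |B v (u - v)| := abs_add_le _ _
    _ ≤ ‖B‖ * ‖u - v‖ * ‖u‖ + ‖B‖ * ‖v‖ * ‖u - v‖ := add_le_add h2 h3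
    _ = ‖B‖ * (‖u‖ + ‖v‖) * ‖u - v‖ := by ring

/-! ## §2 The constraint-adapted strong letter; `δ₀` is the constrained minimiser (non-degeneracy as a theorem) -/

/-- **THE CONSTRAINT-ADAPTED STRONG LETTER** from the road's letters: the strong first-order letter of `V` at `δ₀` with modulus `m∕2`,
the Lagrange condition `V′ = Λ ∘ T`, and the GLOBAL «multiplier × curvature» bound `|Λ (G (δ₀ + v) − G δ₀ − T v)| ≤ ρ‖v‖²` ⟹
`V δ₀ + Λ (G δ − G δ₀) + (m∕2 − ρ)‖δ − δ₀‖² ≤ V δ` for every `δ`.  (Print: `ρ = ‖J‖·B₀·C₂`, small because `J` is small.) [folklore] -/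
theorem firstOrderG_of_firstOrder {V : E → ℝ} {G : E → F} {V' : E →L[ℝ] ℝ} {Λ : F →L[ℝ] ℝ} {T : E →L[ℝ] F} {δ₀ : E}
    (hlag : ∀ v, V' v = Λ (T v)) {m ρ : ℝ} (hfo : ∀ δ, V δ₀ + V' (δ - δ₀) + m / 2 * ‖δ - δ₀‖ ^ 2 ≤ V δ)
    (hcurv : ∀ v, |Λ (G (δ₀ + v) - G δ₀ - T v)| ≤ ρ * ‖v‖ ^ 2) (δ : E) :
    V δ₀ + Λ (G δ - G δ₀) + (m / 2 - ρ) * ‖δ - δ₀‖ ^ 2 ≤ V δ := by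
  have h1 := hfo δ
  have h2 := hcurv (δ - δ₀)
  rw [add_sub_cancel, map_sub Λ (G δ - G δ₀) (T (δ - δ₀)), abs_le] at h2
  rw [hlag] at h1
  nlinarith [h2.1, h2.2]

omit [NormedSpace ℝ E] in
/-- On the fibre of `w₀ + h` the constraint-adapted letter reads `V δ₀ + Λ h + μ‖δ − δ₀‖² ≤ V δ`. [folklore] -/
theorem le_of_firstOrderG {V : E → ℝ} {G : E → F} {Λ : F →L[ℝ] ℝ} {δ₀ : E} {w₀ : F} (hG0 : G δ₀ = w₀) {μ : ℝ}
    (hfoG : ∀ δ, V δ₀ + Λ (G δ - G δ₀) + μ * ‖δ - δ₀‖ ^ 2 ≤ V δ) {δ : E} {h : F} (hδ : G δ = w₀ + h) :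
    V δ₀ + Λ h + μ * ‖δ - δ₀‖ ^ 2 ≤ V δ := by
  have h1 := hfoG δ
  rwa [hδ, hG0, add_sub_cancel_left] at h1

omit [NormedSpace ℝ E] in
/-- **`δ₀` IS THE CONSTRAINED MINIMISER** (`μ ≥ 0`): the non-degeneracy clause of T-85 TOY 1 as a theorem — with a small enough
«multiplier × curvature» (`ρ ≤ m∕2` in `firstOrderG_of_firstOrder`) the stationary point `δ₀` minimises `V` on `{G δ = G δ₀}`. [folklore] -/
theorem isMinOn_fibre_of_firstOrderG {V : E → ℝ} {G : E → F} {Λ : F →L[ℝ] ℝ} {δ₀ : E} {μ : ℝ} (hμ : 0 ≤ μ)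
    (hfoG : ∀ δ, V δ₀ + Λ (G δ - G δ₀) + μ * ‖δ - δ₀‖ ^ 2 ≤ V δ) : ∀ δ, G δ = G δ₀ → V δ₀ ≤ V δ := by
  intro δ hδ
  have h1 := hfoG δ
  rw [hδ, sub_self, map_zero, add_zero] at h1
  nlinarith [sq_nonneg ‖δ - δ₀‖]

/-! ## §3 The UPPER letter: the competitor `σ h` on the nonlinear fibre; the curvature enters through `V′ (σ h − δ₀ − N h)` -/

/-- **THE UPPER SECOND-ORDER LETTER UNDER A NONLINEAR CONSTRAINT.**  A SECTION `σ` near `w₀` (`G (σ h) = w₀ + h` eventually)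
DIFFERENTIABLE AT `0` WITH DERIVATIVE `N` (`σ h − δ₀ − N h = o(h)`; print's chart (47) has even `O(‖h‖²)` contact, (55)); `G δ₀ = w₀`;
`V′ = Λ ∘ T`; the constraint-adapted strong letter
(`μ ≥ 0`, only for `φ w₀ = V δ₀` and fibrewise lower bounds); the UPPER second-order letter of `V` (form `q`) and the LOWER one of
`Λ ∘ (G (δ₀ + ·) − G δ₀ − T)` (form `s`); the quadratic modulus of `𝓛 = q − s` ⟹ `∀ ε > 0`, eventually in `h → 0`:
`φ (w₀ + h) ≤ φ w₀ + Λ h + 𝓛 (N h) + ε‖h‖²`. [folklore] -/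
theorem lagrangian_constrValue_upper {V q s L : E → ℝ} {G : E → F} {V' : E →L[ℝ] ℝ} {Λ : F →L[ℝ] ℝ} {T : E →L[ℝ] F}
    {N : F →L[ℝ] E} {σ : F → E} {w₀ : F} {δ₀ : E} (hG0 : G δ₀ = w₀) (hlag : ∀ v, V' v = Λ (T v))
    {μ : ℝ} (hμ : 0 ≤ μ) (hfoG : ∀ δ, V δ₀ + Λ (G δ - G δ₀) + μ * ‖δ - δ₀‖ ^ 2 ≤ V δ)
    (hV2u : ∀ ε : ℝ, 0 < ε → ∀ᶠ v in 𝓝 (0 : E), V (δ₀ + v) ≤ V δ₀ + V' v + q v + ε * ‖v‖ ^ 2)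
    (hG2l : ∀ ε : ℝ, 0 < ε → ∀ᶠ v in 𝓝 (0 : E), s v ≤ Λ (G (δ₀ + v) - G δ₀ - T v) + ε * ‖v‖ ^ 2)
    (hL : ∀ v, L v = q v - s v) {C : ℝ} (hLmod : ∀ u v, |L u - L v| ≤ C * (‖u‖ + ‖v‖) * ‖u - v‖)
    (hσ : ∀ᶠ h in 𝓝 (0 : F), G (σ h) = w₀ + h) (hσ1 : (fun h => σ h - δ₀ - N h) =o[𝓝 (0 : F)] fun h => h)
    {ε : ℝ} (hε : 0 < ε) :
    ∀ᶠ h in 𝓝 (0 : F), (⨅ δ : {δ // G δ = w₀ + h}, V δ.1)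
      ≤ (⨅ δ : {δ // G δ = w₀}, V δ.1) + Λ h + L (N h) + ε * ‖h‖ ^ 2 := by
  -- constants: `‖σ h − δ₀‖ ≤ K‖h‖` with `K = ‖N‖ + 1` once the contact defect is `≤ η‖h‖`, `η ≤ 1`; the modulus term is `≤ Xη‖h‖²`
  set Cp : ℝ := max C 0 with hCp
  have hCp0 : 0 ≤ Cp := le_max_right _ _
  set K : ℝ := ‖N‖ + 1 with hK
  set X : ℝ := Cp * (K + ‖N‖) with hX
  have hK0 : 0 ≤ K := by positivity
  obtain ⟨hX0, hX1⟩ : 0 ≤ X ∧ X + 1 ≠ 0 := ⟨by positivity, by positivity⟩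
  obtain ⟨hε1, hη⟩ : 0 < ε / (4 * (K ^ 2 + 1)) ∧ 0 < min 1 (ε / (2 * (X + 1))) := ⟨by positivity, by positivity⟩
  obtain ⟨r, hr, hball⟩ := Metric.eventually_nhds_iff.1 ((hV2u _ hε1).and (hG2l _ hε1))
  have hφ0 : (⨅ δ : {δ // G δ = w₀}, V δ.1) = V δ₀ := by
    haveI : Nonempty {δ // G δ = w₀} := ⟨⟨δ₀, hG0⟩⟩
    have hb : BddBelow (range fun δ : {δ // G δ = w₀} => V δ.1) :=
      ⟨V δ₀, forall_mem_range.2 fun δ => isMinOn_fibre_of_firstOrderG hμ hfoG δ.1 (δ.2.trans hG0.symm)⟩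
    exact le_antisymm (ciInf_le hb ⟨δ₀, hG0⟩) (le_ciInf fun δ => isMinOn_fibre_of_firstOrderG hμ hfoG δ.1 (δ.2.trans hG0.symm))
  have hsmall : ∀ᶠ h in 𝓝 (0 : F), ‖h‖ < r / (K + 1) :=
    Metric.eventually_nhds_iff.2 ⟨r / (K + 1), div_pos hr (by positivity), fun h hh => by rwa [dist_zero_right] at hh⟩
  have hτev : ∀ᶠ h in 𝓝 (0 : F), ‖σ h - δ₀ - N h‖ ≤ min 1 (ε / (2 * (X + 1))) * ‖h‖ := hσ1.def hη
  filter_upwards [hσ, hτev, hsmall] with h hGσ hτ hhr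
  set v : E := σ h - δ₀ with hv
  have hτ1 : ‖v - N h‖ ≤ ‖h‖ := hτ.trans ((mul_le_mul_of_nonneg_right (min_le_left _ _) (norm_nonneg h)).trans_eq (one_mul _))
  have hτ2 : ‖v - N h‖ ≤ ε / (2 * (X + 1)) * ‖h‖ := hτ.trans (mul_le_mul_of_nonneg_right (min_le_right _ _) (norm_nonneg h))
  have hvK : ‖v‖ ≤ K * ‖h‖ :=
    calc ‖v‖ ≤ ‖N h‖ + ‖v - N h‖ := by simpa only [add_sub_cancel] using norm_add_le (N h) (v - N h)
      _ ≤ ‖N‖ * ‖h‖ + ‖h‖ := add_le_add (N.le_opNorm h) hτ1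
      _ = K * ‖h‖ := by rw [hK]; ring
  have hvr : dist v 0 < r := by
    rw [dist_zero_right]
    calc ‖v‖ ≤ K * ‖h‖ := hvK
      _ ≤ (K + 1) * ‖h‖ := by nlinarith [norm_nonneg h]
      _ < (K + 1) * (r / (K + 1)) := by gcongr
      _ = r := mul_div_cancel₀ _ (by positivity)
  obtain ⟨hVv, hGv⟩ := hball hvr
  -- the competitor lies on the fibre of `w₀ + h`
  have hfib : G (δ₀ + v) = w₀ + h := by rw [hv, add_sub_cancel]; exact hGσ
  haveI : Nonempty {δ // G δ = w₀ + h} := ⟨⟨δ₀ + v, hfib⟩⟩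
  have hb : BddBelow (range fun δ : {δ // G δ = w₀ + h} => V δ.1) :=
    ⟨V δ₀ + Λ h, forall_mem_range.2 fun δ => by nlinarith [le_of_firstOrderG hG0 hfoG δ.2, sq_nonneg ‖δ.1 - δ₀‖]⟩
  have hφh : (⨅ δ : {δ // G δ = w₀ + h}, V δ.1) ≤ V (δ₀ + v) := ciInf_le hb ⟨δ₀ + v, hfib⟩
  -- the linear term through the constraint: `V′ v = Λ h − Λ(remainder)`
  set R : F := G (δ₀ + v) - G δ₀ - T v with hR
  have hTv : T v = h - R := by rw [hR, hfib, hG0]; abel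
  have hlin : V' v = Λ h - Λ R := by rw [hlag, hTv, map_sub]
  -- the modulus step `L v ≤ L (N h) + C⁺(‖v‖ + ‖N h‖)‖v − N h‖ ≤ L (N h) + X·(ε∕(2(X+1)))‖h‖²`
  have hmod : L v ≤ L (N h) + X * (ε / (2 * (X + 1))) * ‖h‖ ^ 2 := by
    have h1 : |L v - L (N h)| ≤ Cp * (‖v‖ + ‖N h‖) * ‖v - N h‖ := (hLmod v (N h)).trans (by gcongr; exact le_max_left _ _)
    have h2 : ‖v‖ + ‖N h‖ ≤ (K + ‖N‖) * ‖h‖ := by rw [add_mul]; exact add_le_add hvK (N.le_opNorm h)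
    have h3 : Cp * (‖v‖ + ‖N h‖) * ‖v - N h‖ ≤ Cp * ((K + ‖N‖) * ‖h‖) * (ε / (2 * (X + 1)) * ‖h‖) := by gcongr
    have h4 : Cp * ((K + ‖N‖) * ‖h‖) * (ε / (2 * (X + 1)) * ‖h‖) = X * (ε / (2 * (X + 1))) * ‖h‖ ^ 2 := by rw [hX]; ring
    linarith [(abs_le.1 (h1.trans h3)).2]
  have hcube : X * (ε / (2 * (X + 1))) * ‖h‖ ^ 2 ≤ ε / 2 * ‖h‖ ^ 2 := by
    have h4 : X * (ε / (2 * (X + 1))) ≤ (X + 1) * (ε / (2 * (X + 1))) := by gcongr; linarith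
    have h5 : (X + 1) * (ε / (2 * (X + 1))) = ε / 2 := by field_simp [hX1]
    exact mul_le_mul_of_nonneg_right (by linarith) (by positivity)
  have hquad : ε / (4 * (K ^ 2 + 1)) * ‖v‖ ^ 2 + ε / (4 * (K ^ 2 + 1)) * ‖v‖ ^ 2 ≤ ε / 2 * ‖h‖ ^ 2 := by
    have h1 : ‖v‖ ^ 2 ≤ K ^ 2 * ‖h‖ ^ 2 := by rw [← mul_pow]; exact pow_le_pow_left₀ (norm_nonneg _) hvK 2
    have h2 : ε / (4 * (K ^ 2 + 1)) * ‖v‖ ^ 2 ≤ ε / (4 * (K ^ 2 + 1)) * ((K ^ 2 + 1) * ‖h‖ ^ 2) :=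
      mul_le_mul_of_nonneg_left (h1.trans (by nlinarith [sq_nonneg ‖h‖])) hε1.le
    have h3 : ε / (4 * (K ^ 2 + 1)) * ((K ^ 2 + 1) * ‖h‖ ^ 2) = ε / 4 * ‖h‖ ^ 2 := by field_simp
    linarith
  rw [hφ0]
  have hLv : L v = q v - s v := hL v
  linarith [hφh, hVv, hGv, hlin, hmod, hcube, hquad, hLv]

/-! ## §4 The LOWER letter: far fibre points by the strong letter, near ones by the two expansions and `𝓛 v ≥ 𝓛 (N (T v))` -/

/-- **THE LOWER SECOND-ORDER LETTER UNDER A NONLINEAR CONSTRAINT.**  `HasFDerivAt G T δ₀`, `G δ₀ = w₀`, `V′ = Λ ∘ T`,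
the constraint-adapted strong letter with `μ > 0`, the LOWER second-order letter of `V` with form `q` and the UPPER one of
`Λ ∘ (G (δ₀ + ·) − G δ₀ − T)` with form `s`, the quadratic modulus of `𝓛 = q − s` with `𝓛 0 = 0`, `N` minimising `𝓛` on the fibres of
`T` (`𝓛 (N (T v)) ≤ 𝓛 v`), and non-empty fibres near `w₀` (e.g. from a section) ⟹ `∀ ε > 0`, eventually in `h → 0`:
`φ w₀ + Λ h + 𝓛 (N h) ≤ φ (w₀ + h) + ε‖h‖²` (far fibre points, `‖δ − δ₀‖ > A‖h‖` with `A = C⁺‖N‖²∕μ + 1`, lose by the strong letter;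
near ones by the two expansions, `𝓛 (δ − δ₀) ≥ 𝓛 (N (T (δ − δ₀)))` and `T (δ − δ₀) = h − remainder`, `‖remainder‖ ≤ ε″‖δ − δ₀‖`).
[folklore] -/
theorem lagrangian_constrValue_lower {V q s L : E → ℝ} {G : E → F} {V' : E →L[ℝ] ℝ} {Λ : F →L[ℝ] ℝ} {T : E →L[ℝ] F}
    {N : F →L[ℝ] E} {w₀ : F} {δ₀ : E} (hG0 : G δ₀ = w₀) (hT : HasFDerivAt G T δ₀)
    (hlag : ∀ v, V' v = Λ (T v)) {μ : ℝ} (hμ : 0 < μ) (hfoG : ∀ δ, V δ₀ + Λ (G δ - G δ₀) + μ * ‖δ - δ₀‖ ^ 2 ≤ V δ)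
    (hV2l : ∀ ε : ℝ, 0 < ε → ∀ᶠ v in 𝓝 (0 : E), V δ₀ + V' v + q v ≤ V (δ₀ + v) + ε * ‖v‖ ^ 2)
    (hG2u : ∀ ε : ℝ, 0 < ε → ∀ᶠ v in 𝓝 (0 : E), Λ (G (δ₀ + v) - G δ₀ - T v) ≤ s v + ε * ‖v‖ ^ 2)
    (hL : ∀ v, L v = q v - s v) {C : ℝ} (hLmod : ∀ u v, |L u - L v| ≤ C * (‖u‖ + ‖v‖) * ‖u - v‖) (hL0 : L 0 = 0)
    (hNmin : ∀ v, L (N (T v)) ≤ L v) (hne : ∀ᶠ h in 𝓝 (0 : F), ∃ δ, G δ = w₀ + h) {ε : ℝ} (hε : 0 < ε) :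
    ∀ᶠ h in 𝓝 (0 : F), (⨅ δ : {δ // G δ = w₀}, V δ.1) + Λ h + L (N h)
      ≤ (⨅ δ : {δ // G δ = w₀ + h}, V δ.1) + ε * ‖h‖ ^ 2 := by
  set Cp : ℝ := max C 0 with hCp
  have hCp0 : 0 ≤ Cp := le_max_right _ _
  have hLmod' : ∀ u v, |L u - L v| ≤ Cp * (‖u‖ + ‖v‖) * ‖u - v‖ := fun u v => (hLmod u v).trans (by gcongr; exact le_max_left _ _)
  -- `L (N h) ≤ C⁺‖N‖²‖h‖²`
  have hLN : ∀ h : F, L (N h) ≤ Cp * ‖N‖ ^ 2 * ‖h‖ ^ 2 := by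
    intro h
    have h1 := hLmod' (N h) 0
    rw [hL0, sub_zero, norm_zero, add_zero, sub_zero] at h1
    have h3 : ‖N h‖ * ‖N h‖ ≤ (‖N‖ * ‖h‖) * (‖N‖ * ‖h‖) := mul_le_mul (N.le_opNorm h) (N.le_opNorm h) (norm_nonneg _) (by positivity)
    nlinarith [(abs_le.1 h1).2]
  set A : ℝ := Cp * ‖N‖ ^ 2 / μ + 1 with hA
  have hA1 : 1 ≤ A := by linarith [(by positivity : 0 ≤ Cp * ‖N‖ ^ 2 / μ)]
  have hApos : 0 < A := by linarith
  set M : ℝ := Cp * ‖N‖ ^ 2 * (2 + A) * A with hM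
  obtain ⟨hM0, hM1⟩ : 0 ≤ M ∧ 0 < M + 1 := ⟨by positivity, by positivity⟩
  have hε' : 0 < ε / (4 * A ^ 2) := by positivity
  have hε'' : 0 < min 1 (ε / (2 * (M + 1))) := lt_min one_pos (div_pos hε (by positivity))
  obtain ⟨r, hr, hball⟩ := Metric.eventually_nhds_iff.1
    (((hV2l _ hε').and (hG2u _ hε')).and (eventually_norm_remainder_le_of_hasFDerivAt hT hε''))
  have hmin : ∀ δ, G δ = w₀ → V δ₀ ≤ V δ := fun δ hδ => isMinOn_fibre_of_firstOrderG hμ.le hfoG δ (hδ.trans hG0.symm)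
  have hbdd0 : BddBelow (range fun δ : {δ // G δ = w₀} => V δ.1) := ⟨V δ₀, forall_mem_range.2 fun δ => hmin δ.1 δ.2⟩
  have hφ0 : (⨅ δ : {δ // G δ = w₀}, V δ.1) ≤ V δ₀ := ciInf_le hbdd0 ⟨δ₀, hG0⟩
  have hballF : ∀ᶠ h in 𝓝 (0 : F), ‖h‖ < r / A :=
    Metric.eventually_nhds_iff.2 ⟨r / A, div_pos hr hApos, fun h hh => by rwa [dist_zero_right] at hh⟩
  filter_upwards [hballF, hne] with h hh ⟨δ₁, hδ₁⟩
  haveI : Nonempty {δ // G δ = w₀ + h} := ⟨⟨δ₁, hδ₁⟩⟩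
  have hεh : 0 ≤ ε * ‖h‖ ^ 2 := by positivity
  have key : ∀ δ : {δ // G δ = w₀ + h}, V δ₀ + Λ h + L (N h) - ε * ‖h‖ ^ 2 ≤ V δ.1 := by
    rintro ⟨δ, hδ⟩
    set v : E := δ - δ₀ with hv
    have hδv : δ = δ₀ + v := by rw [hv, add_sub_cancel]
    have hstrong : V δ₀ + Λ h + μ * ‖v‖ ^ 2 ≤ V δ := le_of_firstOrderG hG0 hfoG hδ
    by_cases hcase : A * ‖h‖ < ‖v‖
    · -- far from `δ₀`: the strong letter alone
      have h1 : A * ‖h‖ ^ 2 ≤ ‖v‖ ^ 2 := by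
        have h1a : (A * ‖h‖) ^ 2 ≤ ‖v‖ ^ 2 := pow_le_pow_left₀ (by positivity) hcase.le 2
        have h1b : A * ‖h‖ ^ 2 ≤ (A * ‖h‖) ^ 2 := by
          rw [mul_pow]; exact mul_le_mul_of_nonneg_right (by nlinarith) (sq_nonneg _)
        exact h1b.trans h1a
      have h2 : μ * (A * ‖h‖ ^ 2) = (Cp * ‖N‖ ^ 2 + μ) * ‖h‖ ^ 2 := by rw [hA]; field_simp
      have h3a : μ * (A * ‖h‖ ^ 2) ≤ μ * ‖v‖ ^ 2 := mul_le_mul_of_nonneg_left h1 hμ.le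
      have h3b : 0 ≤ μ * ‖h‖ ^ 2 := by positivity
      simp only
      linarith [hLN h]
    · -- near `δ₀`: the two expansions and the fibre comparison
      rw [not_lt] at hcase
      have hvr : dist v 0 < r := by
        rw [dist_zero_right]
        calc ‖v‖ ≤ A * ‖h‖ := hcase
          _ < A * (r / A) := by gcongr
          _ = r := mul_div_cancel₀ _ hApos.ne'
      obtain ⟨⟨hVv, hGv⟩, hRv⟩ := hball hvr
      rw [← hδv] at hVv hGv hRv
      set R : F := G δ - G δ₀ - T v with hR
      have hTv : T v = h - R := by rw [hR, hδ, hG0]; abel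
      have hlin : V' v = Λ h - Λ R := by rw [hlag, hTv, map_sub]
      have hNv : L (N (h - R)) ≤ L v := by rw [← hTv]; exact hNmin v
      have hR1 : ‖R‖ ≤ ‖v‖ := hRv.trans ((mul_le_mul_of_nonneg_right (min_le_left _ _) (norm_nonneg v)).trans_eq (one_mul _))
      have hR2 : ‖R‖ ≤ ε / (2 * (M + 1)) * ‖v‖ := hRv.trans (mul_le_mul_of_nonneg_right (min_le_right _ _) (norm_nonneg _))
      -- `L (N h) ≤ L (N (h − R)) + C⁺(‖N h‖ + ‖N (h − R)‖)‖N R‖`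
      have hmodN : L (N h) ≤ L (N (h - R)) + Cp * (‖N‖ * ((2 + A) * ‖h‖)) * (‖N‖ * ‖R‖) := by
        have h1 := hLmod' (N h) (N (h - R))
        have h2 : ‖N h - N (h - R)‖ ≤ ‖N‖ * ‖R‖ := by rw [← map_sub, sub_sub_cancel]; exact N.le_opNorm R
        have h6 : ‖R‖ ≤ A * ‖h‖ := hR1.trans hcase
        have h3 : ‖N h‖ + ‖N (h - R)‖ ≤ ‖N‖ * ((2 + A) * ‖h‖) :=
          calc ‖N h‖ + ‖N (h - R)‖ ≤ ‖N‖ * ‖h‖ + ‖N‖ * ‖h - R‖ := add_le_add (N.le_opNorm h) (N.le_opNorm _)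
            _ ≤ ‖N‖ * ‖h‖ + ‖N‖ * (‖h‖ + ‖R‖) := by gcongr; exact norm_sub_le _ _
            _ ≤ ‖N‖ * ‖h‖ + ‖N‖ * (‖h‖ + A * ‖h‖) := by gcongr
            _ = ‖N‖ * ((2 + A) * ‖h‖) := by ring
        have h7 : Cp * (‖N h‖ + ‖N (h - R)‖) * ‖N h - N (h - R)‖ ≤ Cp * (‖N‖ * ((2 + A) * ‖h‖)) * (‖N‖ * ‖R‖) := by gcongr
        linarith [(abs_le.1 (h1.trans h7)).2]
      have hcross : Cp * (‖N‖ * ((2 + A) * ‖h‖)) * (‖N‖ * ‖R‖) ≤ ε / 2 * ‖h‖ ^ 2 := by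
        have h1 : ‖R‖ ≤ ε / (2 * (M + 1)) * (A * ‖h‖) := hR2.trans (by gcongr)
        calc Cp * (‖N‖ * ((2 + A) * ‖h‖)) * (‖N‖ * ‖R‖)
            ≤ Cp * (‖N‖ * ((2 + A) * ‖h‖)) * (‖N‖ * (ε / (2 * (M + 1)) * (A * ‖h‖))) := by gcongr
          _ = (Cp * ‖N‖ ^ 2 * (2 + A) * A) * (ε / (2 * (M + 1))) * ‖h‖ ^ 2 := by ring
          _ = M * (ε / (2 * (M + 1))) * ‖h‖ ^ 2 := by rw [← hM]
          _ ≤ (M + 1) * (ε / (2 * (M + 1))) * ‖h‖ ^ 2 := by gcongr; linarith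
          _ = ε / 2 * ‖h‖ ^ 2 := by field_simp [hM1.ne']
      have hquad : ε / (4 * A ^ 2) * ‖v‖ ^ 2 + ε / (4 * A ^ 2) * ‖v‖ ^ 2 ≤ ε / 2 * ‖h‖ ^ 2 := by
        have h1 : ‖v‖ ^ 2 ≤ A ^ 2 * ‖h‖ ^ 2 := by rw [← mul_pow]; exact pow_le_pow_left₀ (norm_nonneg _) hcase 2
        have h2 : ε / (4 * A ^ 2) * ‖v‖ ^ 2 ≤ ε / (4 * A ^ 2) * (A ^ 2 * ‖h‖ ^ 2) := mul_le_mul_of_nonneg_left h1 hε'.le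
        have h3 : ε / (4 * A ^ 2) * (A ^ 2 * ‖h‖ ^ 2) = ε / 4 * ‖h‖ ^ 2 := by field_simp
        linarith
      have hLv : L v = q v - s v := hL v
      simp only
      linarith [hVv, hGv, hlin, hNv, hmodN, hcross, hquad, hLv]
  linarith [le_ciInf key]

/-! ## §5 THE END: the second-order term of the value function is the constrained Schur form of the LAGRANGIAN form `𝓛 = q − s` -/

/-- **THE SECOND-ORDER ENVELOPE THEOREM UNDER A NONLINEAR CONSTRAINT (Peano form).**  Data: the LINEARISED constraint `T : E →L F`
(`HasFDerivAt G T δ₀`, `G δ₀ = w₀`) and `N : F →L E` (a right inverse of `T` in every application — forced by the letters, never used);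
the Lagrange condition `V′ = Λ ∘ T` (`Λ` the multiplier — CVD §5); the constraint-adapted strong letter with `μ > 0` (§2); the two
second-order expansions at `δ₀`, of `V` (form `q`) and of `Λ ∘ (G (δ₀ + ·) − G δ₀ − T)` (form `s` = multiplier × curvature, print's
`⟨HC⁽²⁾(v), J⟩`); the LAGRANGIAN FORM `𝓛 = q − s` with a quadratic modulus (§1) and `N` minimising it on the fibres of `T`; a section
`σ` of `G` near `w₀`, differentiable at `0` with `σ 0 = δ₀` and derivative `N` (print's chart (47), contact (55)) ⟹
`(h ↦ φ (w₀ + h) − φ w₀ − Λ h − 𝓛 (N h)) =o[𝓝 0] ‖h‖²`, `φ w = ⨅_{G δ = w} V δ`: the value function's second-order term is `𝓛 ∘ N` —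
by CVS §1 the CONSTRAINED SCHUR FORM `𝓛_T` of the LAGRANGIAN form over the linearised constraint («`D²φ` = the constrained Schur
complement of `D²V − λ∘D²G`», T-85 (E2)); for a linear `G` (`s = 0`, `σ h = δ₀ + N h`) this is CVS §5. [folklore] -/
theorem isLittleO_constrValue_lagrangian {V q s L : E → ℝ} {G : E → F} {V' : E →L[ℝ] ℝ} {Λ : F →L[ℝ] ℝ} {T : E →L[ℝ] F}
    {N : F →L[ℝ] E} {σ : F → E} {w₀ : F} {δ₀ : E} (hG0 : G δ₀ = w₀) (hT : HasFDerivAt G T δ₀)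
    (hlag : ∀ v, V' v = Λ (T v)) {μ : ℝ} (hμ : 0 < μ) (hfoG : ∀ δ, V δ₀ + Λ (G δ - G δ₀) + μ * ‖δ - δ₀‖ ^ 2 ≤ V δ)
    (hV2 : (fun v => V (δ₀ + v) - V δ₀ - V' v - q v) =o[𝓝 (0 : E)] fun v => ‖v‖ ^ 2)
    (hG2 : (fun v => Λ (G (δ₀ + v) - G δ₀ - T v) - s v) =o[𝓝 (0 : E)] fun v => ‖v‖ ^ 2)
    (hL : ∀ v, L v = q v - s v) {C : ℝ} (hLmod : ∀ u v, |L u - L v| ≤ C * (‖u‖ + ‖v‖) * ‖u - v‖)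
    (hNmin : ∀ v, L (N (T v)) ≤ L v)
    (hσ : ∀ᶠ h in 𝓝 (0 : F), G (σ h) = w₀ + h) (hσ1 : (fun h => σ h - δ₀ - N h) =o[𝓝 (0 : F)] fun h => h) :
    (fun h => (⨅ δ : {δ // G δ = w₀ + h}, V δ.1) - (⨅ δ : {δ // G δ = w₀}, V δ.1) - Λ h - L (N h))
      =o[𝓝 (0 : F)] fun h => ‖h‖ ^ 2 := by
  have hq0 : q 0 = 0 := by
    have h := apply_zero_of_isLittleO_sq hV2
    simp only [add_zero, sub_self, map_zero, zero_sub, neg_eq_zero] at h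
    exact h
  have hs0 : s 0 = 0 := by
    have h := apply_zero_of_isLittleO_sq hG2
    simp only [add_zero, sub_self, map_zero, zero_sub, neg_eq_zero] at h
    exact h
  have hL0 : L 0 = 0 := by rw [hL, hq0, hs0, sub_zero]
  have hne : ∀ᶠ h in 𝓝 (0 : F), ∃ δ, G δ = w₀ + h := hσ.mono fun h hh => ⟨σ h, hh⟩
  refine isLittleO_iff.2 fun ε hε => ?_
  have hu := lagrangian_constrValue_upper (N := N) hG0 hlag hμ.le hfoG
    (fun ε' hε' => (eventually_abs_le_sq_of_isLittleO hV2 hε').mono fun v hv => by linarith [(abs_le.1 hv).2])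
    (fun ε' hε' => (eventually_abs_le_sq_of_isLittleO hG2 hε').mono fun v hv => by linarith [(abs_le.1 hv).1])
    hL hLmod hσ hσ1 hε
  have hl := lagrangian_constrValue_lower hG0 hT hlag hμ hfoG
    (fun ε' hε' => (eventually_abs_le_sq_of_isLittleO hV2 hε').mono fun v hv => by linarith [(abs_le.1 hv).1])
    (fun ε' hε' => (eventually_abs_le_sq_of_isLittleO hG2 hε').mono fun v hv => by linarith [(abs_le.1 hv).2])
    hL hLmod hL0 hNmin hne hε
  filter_upwards [hu, hl] with h hhu hhl
  rw [Real.norm_eq_abs, Real.norm_of_nonneg (by positivity), abs_le]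
  constructor <;> linarith

end Main

/-! ## §6 Toy check (kernel): the letters are jointly inhabited — `G = T = N = id`, `s = 0`, `σ h = δ₀ + h`: `V`'s own expansion -/

example {E : Type*} [NormedAddCommGroup E] [NormedSpace ℝ E] {V q : E → ℝ} {V' : E →L[ℝ] ℝ} {δ₀ : E} {μ : ℝ} (hμ : 0 < μ)
    (hfo : ∀ δ, V δ₀ + V' (δ - δ₀) + μ * ‖δ - δ₀‖ ^ 2 ≤ V δ)
    (hV2 : (fun v => V (δ₀ + v) - V δ₀ - V' v - q v) =o[𝓝 (0 : E)] fun v => ‖v‖ ^ 2)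
    {C : ℝ} (hqmod : ∀ u v, |q u - q v| ≤ C * (‖u‖ + ‖v‖) * ‖u - v‖) :
    (fun h => (⨅ δ : {δ // (fun x : E => x) δ = δ₀ + h}, V δ.1) - (⨅ δ : {δ // (fun x : E => x) δ = δ₀}, V δ.1) - V' h
        - q ((ContinuousLinearMap.id ℝ E) h)) =o[𝓝 (0 : E)] fun h => ‖h‖ ^ 2 :=
  isLittleO_constrValue_lagrangian (G := fun x : E => x) (T := ContinuousLinearMap.id ℝ E) (N := ContinuousLinearMap.id ℝ E)
    (s := fun _ => 0) (L := q) (σ := fun h => δ₀ + h) rfl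
    ((ContinuousLinearMap.id ℝ E).hasFDerivAt) (fun _ => rfl) hμ (fun δ => by simpa using hfo δ) hV2
    (by simp) (fun v => by simp) hqmod (fun _ => le_rfl) (Eventually.of_forall fun h => rfl)
    (by simp)

end Summit.QuantumFields.BalabanUV.T4Continuum.NE7b.ConstrainedValueLagrangian
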